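import Literature.NumberTheory.Sieve.LargestPrimeFactorCubicRootPairs
import Literature.NumberTheory.Sieve.LargestPrimeFactorCubicScountRect
import Literature.NumberTheory.Sieve.LargestPrimeFactorCubicGeomPairSum
import HarnessLib

/-!
# Heath-Brown 2001 (PLMS), Lemma 10 in root language:
# `∑_{q ≤ Q} ∑_{k³ ≡ 2 (q)} |S(q,k) − U₁U₂/q| ≪ (U₂ + Q) Q^ε`

Topic `Literature/NumberTheory/Sieve`; a PROVED layer (definitions with bodies, no named facts) under
the named fact `Irving2015_largestPrimeFactor_cubic` (`LargestPrimeFactorCubic.lean`), assembling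
`…RootPairs` (the classes `q ∣ mk − d'` have `≪ Q^ε` members), `…SawCount` (`S(q,k) − U²/q` as
sawtooth sums, bounded by geometric sums) and `…GeomPairSum` (summation of the geometric-sum majorant
over the pairs).  Source: D. R. Heath-Brown, *The largest prime factor of `X³ + 2`*, Proc. London
Math. Soc. (3) 82 (2001) 554–596, §7, **Lemma 10** p. 23:

  `∑_{N(R) ≤ Q, ρ(R)=1} |S(R) − U²/N(R)| ≪ (U + Q) Q^ε`,  `S(R) = #{A < a ≤ A+U, B < b ≤ B+U : R ∣ a − b∛2}`.

We PROVE it for RECTANGLES `(A, A+U₁] × (B, B+U₂]` (needed for (7.3), where the box is divided by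
`d`), in root language (`(N(R), k)` ↦ `(q, k) ∈ rootPairs Q`; the translation to ideals is the
parallel seat's `LargestPrimeFactorCubicRoots`):

  **`exists_sum_rootPairs_abs_Scount₂_sub_le`**: for every `ε > 0` there is `C` with
  `∑_{(q,k) ∈ rootPairs Q} |S(q,k; A,U₁,B,U₂) − U₁U₂/q| ≤ C (U₂ + Q) Q^ε`  for all `Q ≥ 1`, `A, B, U₁, U₂`.

Route (one-variable form of Heath-Brown's Fourier argument, V = Q in the Vaaler–Fejér inequality):
`|S − U₁U₂/q| ≤ 2M(q,k)` (`…SawCount`), `∑_{(q,k)} M(q,k) = (1/π)∑_ν ν⁻¹ ∑_{(q,k)} G(νk/q) + c_Q ∑_d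
∑_{(q,k)} G(dk/q)`; for `m ≠ 0`, `|m| ≤ 5(2Q+1)`, `|d'| ≤ Q` the class `q ∣ mk − d'` has at most
`C_r Q^{ε₁} τ(|d'³ − 2m³|) ≤ K = C Q^{ε₁+3ε₂}` members (`…RootPairs`), so `∑_{(q,k)} G(mk/q) ≤
K(U₂ + Q(1 + log Q))` (`…GeomPairSum`); the term `m = 0` is `U₂ · #rootPairs Q ≤ U₂ C_r Q^{1+ε₁}` with
the coefficient `c_Q ≤ 3(2 + log(2Q+1))/(2Q+1)`; logarithms are absorbed by `log x ≤ x^δ/δ`.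

## References

* D. R. Heath-Brown, *The largest prime factor of `X³ + 2`*, Proc. London Math. Soc. (3) 82 (2001)
  554–596, §7, Lemma 10, pp. 23–25. [`HeathBrown2001LargestPrimeFactorCubic`]

## Mathlib / tree search

Tree: `rootPairs`, `rootsCube`, `exists_card_rootsCube_le_rpow`, `card_rootPairs_dvd_le` (`…RootPairs`);
`Scount₂`, `abs_Scount₂_sub_le` (`…ScountRect`), `sawMajorant`, `cV` (`…SawCount`);
`sum_pairs_geomBound_le_of_Icc` (`…GeomPairSum`); `exists_card_divisors_le_mul_rpow` (`DivisorBound`).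
Mathlib: `harmonic_le_one_add_log`, `harmonic_eq_sum_Icc`, `Real.log_le_rpow_div`, `Finset.sum_comm`,
`Finset.card_sigma`.
-/

noncomputable section

open Finset Real

namespace Literature.NumberTheory.Sieve.HeathBrown2001

open Literature.NumberTheory.LFunctions.AFE (saw)
open Literature.NumberTheory.Sieve.Vinogradov (geomBound geomBound_zero geomBound_nonneg)

/-! ### Facts about `rootPairs Q` -/

/-- Members of `rootPairs Q` have `1 ≤ q ≤ Q`. [folklore] -/
theorem rootPairs_bounds {Q : ℕ} {qk : Σ _ : ℕ, ℕ} (h : qk ∈ rootPairs Q) : 0 < qk.1 ∧ qk.1 ≤ Q := by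
  unfold rootPairs at h
  rw [mem_sigma, mem_Icc] at h
  exact ⟨h.1.1, h.1.2⟩

/-- `#rootPairs Q ≤ C_r Q^{1+ε₁}` given `#rootsCube q ≤ C_r q^{ε₁}`. [folklore] -/
theorem card_rootPairs_le {C ε : ℝ} (hC : 0 ≤ C) (hε : 0 ≤ ε)
    (hroot : ∀ q : ℕ, q ≠ 0 → (#(rootsCube q) : ℝ) ≤ C * (q : ℝ) ^ ε) (Q : ℕ) :
    (#(rootPairs Q) : ℝ) ≤ C * (Q : ℝ) ^ ε * Q := by
  unfold rootPairs
  rw [card_sigma]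
  push_cast
  calc ∑ q ∈ Icc 1 Q, (#(rootsCube q) : ℝ) ≤ ∑ _q ∈ Icc 1 Q, C * (Q : ℝ) ^ ε := by
        refine sum_le_sum fun q hq => ?_
        rw [mem_Icc] at hq
        calc (#(rootsCube q) : ℝ) ≤ C * (q : ℝ) ^ ε := hroot q (by omega)
          _ ≤ C * (Q : ℝ) ^ ε := by gcongr; exact_mod_cast hq.2
    _ = C * (Q : ℝ) ^ ε * Q := by
        rw [sum_const, Nat.card_Icc, nsmul_eq_mul]; push_cast; ring

/-! ### The class bound `K` -/

/-- For `m ≠ 0`, `|m| ≤ 15Q`, `|d'| ≤ Q`: `τ(|d'³ − 2m³|) ≤ C_d (6751 Q³)^{ε₂}`. [folklore] -/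
theorem card_divisors_cube_le {C ε : ℝ} (hC : 0 ≤ C) (hε : 0 ≤ ε)
    (hdiv : ∀ n : ℕ, n ≠ 0 → (#n.divisors : ℝ) ≤ C * (n : ℝ) ^ ε)
    {Q : ℕ} {m d' : ℤ} (hm : m ≠ 0 ∨ d' ≠ 0) (hmQ : |m| ≤ 15 * Q) (hd' : |d'| ≤ Q) :
    (#((d' ^ 3 - 2 * m ^ 3).natAbs.divisors) : ℝ) ≤ C * (6751 * (Q : ℝ) ^ 3) ^ ε := by
  set n : ℕ := (d' ^ 3 - 2 * m ^ 3).natAbs with hn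
  have hn0 : n ≠ 0 := by
    rw [hn]; refine Int.natAbs_ne_zero.mpr (cube_sub_two_mul_cube_ne_zero ?_)
    rintro ⟨h1, h2⟩
    rcases hm with h | h
    · exact h h1
    · exact h h2
  have hnle : (n : ℝ) ≤ 6751 * (Q : ℝ) ^ 3 := by
    have h1 : ((n : ℤ) : ℝ) = |((d' ^ 3 - 2 * m ^ 3 : ℤ) : ℝ)| := by
      rw [hn, Int.natCast_natAbs, Int.cast_abs]
    have h2 : (n : ℝ) = |(d' : ℝ) ^ 3 - 2 * (m : ℝ) ^ 3| := by
      have := h1; push_cast at this ⊢; exact this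
    rw [h2]
    have hdR : |(d' : ℝ)| ≤ Q := by rw [← Int.cast_abs]; exact_mod_cast hd'
    have hmR : |(m : ℝ)| ≤ 15 * Q := by rw [← Int.cast_abs]; exact_mod_cast hmQ
    have hQ0 : (0 : ℝ) ≤ Q := Nat.cast_nonneg Q
    calc |(d' : ℝ) ^ 3 - 2 * (m : ℝ) ^ 3| ≤ |(d' : ℝ) ^ 3| + |2 * (m : ℝ) ^ 3| := abs_sub _ _
      _ = |(d' : ℝ)| ^ 3 + 2 * |(m : ℝ)| ^ 3 := by rw [abs_pow, abs_mul, abs_pow]; norm_num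
      _ ≤ (Q : ℝ) ^ 3 + 2 * (15 * Q) ^ 3 := by gcongr
      _ = 6751 * (Q : ℝ) ^ 3 := by ring
  calc (#(n.divisors) : ℝ) ≤ C * (n : ℝ) ^ ε := hdiv n hn0
    _ ≤ C * (6751 * (Q : ℝ) ^ 3) ^ ε := by gcongr

/-! ### Lemma 10 -/

/-- `log x ≤ x^δ/δ` for `x ≥ 0`, `δ > 0` (Mathlib), in the form `1 + log Q ≤ (1 + 1/δ) Q^δ` for `Q ≥ 1`.
[folklore] -/
theorem one_add_log_le {Q : ℕ} (hQ : 1 ≤ Q) {δ : ℝ} (hδ : 0 < δ) :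
    1 + Real.log Q ≤ (1 + 1 / δ) * (Q : ℝ) ^ δ := by
  have hQ1 : (1 : ℝ) ≤ Q := by exact_mod_cast hQ
  have h1 : (1 : ℝ) ≤ (Q : ℝ) ^ δ := Real.one_le_rpow hQ1 hδ.le
  have h2 : Real.log Q ≤ (Q : ℝ) ^ δ / δ := Real.log_le_rpow_div (by linarith) hδ
  calc 1 + Real.log Q ≤ (Q : ℝ) ^ δ + (Q : ℝ) ^ δ / δ := add_le_add h1 h2
    _ = (1 + 1 / δ) * (Q : ℝ) ^ δ := by ring

/-- `2 + log(2Q+1) ≤ (4 + 1/δ) Q^δ` for `Q ≥ 1`, `δ > 0`. [folklore] -/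
theorem two_add_log_le {Q : ℕ} (hQ : 1 ≤ Q) {δ : ℝ} (hδ : 0 < δ) :
    2 + Real.log (2 * Q + 1) ≤ (4 + 1 / δ) * (Q : ℝ) ^ δ := by
  have hQ1 : (1 : ℝ) ≤ Q := by exact_mod_cast hQ
  have h1 : (1 : ℝ) ≤ (Q : ℝ) ^ δ := Real.one_le_rpow hQ1 hδ.le
  have hlog : Real.log (2 * Q + 1) ≤ Real.log 3 + Real.log Q := by
    rw [← Real.log_mul (by norm_num) (by linarith)]
    exact Real.log_le_log (by linarith) (by linarith)
  have h3 : Real.log 3 < 2 := by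
    have := Real.log_lt_sub_one_of_pos (by norm_num : (0:ℝ) < 3) (by norm_num); linarith
  have h2 : Real.log Q ≤ (Q : ℝ) ^ δ / δ := Real.log_le_rpow_div (by linarith) hδ
  calc 2 + Real.log (2 * Q + 1) ≤ 4 * 1 + (Q : ℝ) ^ δ / δ := by linarith
    _ ≤ 4 * (Q : ℝ) ^ δ + (Q : ℝ) ^ δ / δ := by gcongr
    _ = (4 + 1 / δ) * (Q : ℝ) ^ δ := by ring

set_option maxHeartbeats 4000000 in
/-- **Heath-Brown's Lemma 10 (root language, rectangles)**: for every `ε > 0` there is `C > 0` such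
that for all `Q ≥ 1` and all `A, U₁, B, U₂`,
`∑_{(q,k) ∈ rootPairs Q} |S(q,k; A,U₁,B,U₂) − U₁U₂/q| ≤ C (U₂ + Q) Q^ε`.
[cite: HeathBrown2001LargestPrimeFactorCubic, Lemma 10 p. 23] -/
theorem exists_sum_rootPairs_abs_Scount₂_sub_le {ε : ℝ} (hε : 0 < ε) :
    ∃ C : ℝ, 0 < C ∧ ∀ Q : ℕ, 1 ≤ Q → ∀ A U₁ B U₂ : ℕ,
      ∑ qk ∈ rootPairs Q, |(Scount₂ qk.1 qk.2 A U₁ B U₂ : ℝ) - (U₁ : ℝ) * U₂ / qk.1| ≤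
        C * ((U₂ : ℝ) + Q) * (Q : ℝ) ^ ε := by
  -- constants
  set δ : ℝ := ε / 8 with hδ
  have hδ0 : 0 < δ := by rw [hδ]; positivity
  obtain ⟨Cr, hCr1, hCr⟩ := exists_card_rootsCube_le_rpow hδ0
  obtain ⟨Cd, hCd1, hCd⟩ := exists_card_divisors_le_mul_rpow (ε := δ / 3) (by positivity)
  have hCr0 : 0 ≤ Cr := by linarith
  have hCd0 : 0 ≤ Cd := by linarith
  -- the class constant `K = Cr Cd 6751^{δ/3} Q^{2δ}` and the log constant
  set κ : ℝ := Cr * (Cd * (6751 : ℝ) ^ (δ / 3)) with hκ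
  have hκ0 : 0 ≤ κ := by rw [hκ]; positivity
  set Λ : ℝ := 4 + 1 / δ with hΛ
  have hΛ1 : 1 ≤ Λ := by rw [hΛ]; have := one_div_pos.mpr hδ0; linarith
  -- final constant
  refine ⟨2 * ((1 / π) * Λ * κ * (2 * Λ) + 30 * Λ * κ * (2 * Λ) + 3 * Λ * Cr) + 1, by positivity, ?_⟩
  intro Q hQ A U₁ B U₂
  have hQ0 : (0 : ℝ) < Q := by exact_mod_cast hQ
  have hQ1 : (1 : ℝ) ≤ Q := by exact_mod_cast hQ
  have hQδ1 : (1 : ℝ) ≤ (Q : ℝ) ^ δ := Real.one_le_rpow hQ1 hδ0.le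
  set P := rootPairs Q with hP
  have hPb : ∀ qk ∈ P, 0 < qk.1 ∧ qk.1 ≤ Q := fun qk h => rootPairs_bounds h
  -- Step 1: per pair
  have step1 : ∑ qk ∈ P, |(Scount₂ qk.1 qk.2 A U₁ B U₂ : ℝ) - (U₁ : ℝ) * U₂ / qk.1| ≤
      2 * ∑ qk ∈ P, sawMajorant Q U₂ qk.2 qk.1 := by
    rw [mul_sum]
    exact sum_le_sum fun qk hqk => abs_Scount₂_sub_le (hPb qk hqk).1 hQ _ _ _ _ _
  -- Step 2: the class bound
  set K : ℝ := κ * (Q : ℝ) ^ (2 * δ) with hK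
  have hK0 : 0 ≤ K := by rw [hK]; positivity
  have hclass : ∀ m : ℤ, m ≠ 0 → |m| ≤ 15 * Q → ∀ d' ∈ Icc (-(Q : ℤ)) Q,
      (#(P.filter fun qk => ((qk.1 : ℕ) : ℤ) ∣ m * qk.2 - d') : ℝ) ≤ K := by
    intro m hm hmQ d' hd'
    rw [mem_Icc, ← abs_le] at hd'
    have h1 := card_rootPairs_dvd_le hCr0 hδ0.le hCr Q (ν := m) (d := d') (fun h => hm h.1)
    have h2 := card_divisors_cube_le hCd0 (by positivity) hCd (Or.inl hm) hmQ hd'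
    calc (#(P.filter fun qk => ((qk.1 : ℕ) : ℤ) ∣ m * qk.2 - d') : ℝ)
        ≤ Cr * (Q : ℝ) ^ δ * #((d' ^ 3 - 2 * m ^ 3).natAbs.divisors) := h1
      _ ≤ Cr * (Q : ℝ) ^ δ * (Cd * (6751 * (Q : ℝ) ^ 3) ^ (δ / 3)) := by gcongr
      _ = K := by
          rw [hK, hκ, Real.mul_rpow (by norm_num) (by positivity), ← Real.rpow_natCast,
            ← Real.rpow_mul hQ0.le]
          rw [show ((3 : ℕ) : ℝ) * (δ / 3) = δ by push_cast; ring, show 2 * δ = δ + δ by ring,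
            Real.rpow_add hQ0]
          ring
  -- Step 3: the geometric sums over pairs, `m ≠ 0`
  set W : ℝ := (U₂ : ℝ) + (Q : ℝ) * ∑ i ∈ Icc 1 Q, (1 : ℝ) / i with hW
  have hharm : ∑ i ∈ Icc 1 Q, (1 : ℝ) / i ≤ 1 + Real.log Q := by
    have h := harmonic_le_one_add_log Q
    have e : ∑ i ∈ Icc 1 Q, (1 : ℝ) / i = (harmonic Q : ℝ) := by
      rw [harmonic_eq_sum_Icc]; push_cast
      exact sum_congr rfl fun i _ => by simp
    rw [e]; exact h
  have hW0 : 0 ≤ W := by rw [hW]; positivity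
  have hWle : W ≤ ((U₂ : ℝ) + Q) * (Λ * (Q : ℝ) ^ δ) := by
    have h1 : (Q : ℝ) * ∑ i ∈ Icc 1 Q, (1 : ℝ) / i ≤ Q * ((1 + 1 / δ) * (Q : ℝ) ^ δ) :=
      mul_le_mul_of_nonneg_left (hharm.trans (one_add_log_le hQ hδ0)) hQ0.le
    have h2 : (U₂ : ℝ) ≤ U₂ * (Λ * (Q : ℝ) ^ δ) := by
      have : (1 : ℝ) ≤ Λ * (Q : ℝ) ^ δ := by nlinarith
      nlinarith [Nat.cast_nonneg (α := ℝ) U₂]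
    have h3 : (1 + 1 / δ) ≤ Λ := by rw [hΛ]; linarith
    rw [hW]
    nlinarith [mul_nonneg hQ0.le (Real.rpow_nonneg hQ0.le δ), Nat.cast_nonneg (α := ℝ) U₂]
  have hgeom : ∀ m : ℤ, m ≠ 0 → |m| ≤ 15 * Q →
      ∑ qk ∈ P, geomBound U₂ ((m : ℝ) * qk.2 / qk.1) ≤ K * W := fun m hm hmQ =>
    sum_pairs_geomBound_le_of_Icc P hPb U₂ (hclass m hm hmQ)
  -- Step 4: sum the majorant
  set H : ℕ := 5 * (2 * Q + 1) with hH
  have hHQ : (H : ℤ) ≤ 15 * Q := by rw [hH]; push_cast; omega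
  have hνsum : ∑ qk ∈ P, ∑ ν ∈ Icc 1 Q, geomBound U₂ ((ν : ℝ) * qk.2 / qk.1) / ν ≤
      (1 + Real.log Q) * (K * W) := by
    rw [sum_comm]
    calc ∑ ν ∈ Icc 1 Q, ∑ qk ∈ P, geomBound U₂ ((ν : ℝ) * qk.2 / qk.1) / ν
        = ∑ ν ∈ Icc 1 Q, (1 / (ν : ℝ)) * ∑ qk ∈ P, geomBound U₂ (((ν : ℤ) : ℝ) * qk.2 / qk.1) := by
          refine sum_congr rfl fun ν _ => ?_
          rw [mul_sum]
          refine sum_congr rfl fun qk _ => ?_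
          push_cast; ring
      _ ≤ ∑ ν ∈ Icc 1 Q, (1 / (ν : ℝ)) * (K * W) := by
          refine sum_le_sum fun ν hν => ?_
          rw [mem_Icc] at hν
          refine mul_le_mul_of_nonneg_left (hgeom ν (by exact_mod_cast (by omega : ν ≠ 0)) ?_) (by positivity)
          rw [Nat.abs_cast]; exact_mod_cast (by omega : ν ≤ 15 * Q)
      _ = (∑ ν ∈ Icc 1 Q, (1 : ℝ) / ν) * (K * W) := by rw [sum_mul]
      _ ≤ (1 + Real.log Q) * (K * W) := by gcongr
  have hdsum : ∑ qk ∈ P, ∑ d ∈ Icc (-(H : ℤ)) H, geomBound U₂ ((d : ℝ) * qk.2 / qk.1) ≤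
      (2 * H) * (K * W) + U₂ * (Cr * (Q : ℝ) ^ δ * Q) := by
    rw [sum_comm]
    -- split off `d = 0`
    have h0mem : (0 : ℤ) ∈ Icc (-(H : ℤ)) H := by rw [mem_Icc]; omega
    rw [← add_sum_erase _ _ h0mem]
    have hzero : ∑ qk ∈ P, geomBound U₂ (((0 : ℤ) : ℝ) * qk.2 / qk.1) = U₂ * #P := by
      simp only [Int.cast_zero, zero_mul, zero_div, geomBound_zero, sum_const, nsmul_eq_mul]
      ring
    rw [hzero]
    have hrest : ∑ d ∈ (Icc (-(H : ℤ)) H).erase 0, ∑ qk ∈ P, geomBound U₂ ((d : ℝ) * qk.2 / qk.1) ≤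
        (2 * H) * (K * W) := by
      calc ∑ d ∈ (Icc (-(H : ℤ)) H).erase 0, ∑ qk ∈ P, geomBound U₂ ((d : ℝ) * qk.2 / qk.1)
          ≤ ∑ _d ∈ (Icc (-(H : ℤ)) H).erase 0, K * W := by
            refine sum_le_sum fun d hd => ?_
            rw [mem_erase, mem_Icc] at hd
            exact hgeom d hd.1 (abs_le.mpr ⟨by omega, by omega⟩)
        _ = #((Icc (-(H : ℤ)) H).erase 0) * (K * W) := by rw [sum_const, nsmul_eq_mul]
        _ = (2 * H) * (K * W) := by
            have : #((Icc (-(H : ℤ)) H).erase 0) = 2 * H := by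
              rw [card_erase_of_mem h0mem, Int.card_Icc]; omega
            rw [this]; push_cast; ring
    have hPcard := card_rootPairs_le hCr0 hδ0.le hCr Q
    have : (U₂ : ℝ) * #P ≤ U₂ * (Cr * (Q : ℝ) ^ δ * Q) := mul_le_mul_of_nonneg_left hPcard (Nat.cast_nonneg _)
    linarith
  have hmaj : ∑ qk ∈ P, sawMajorant Q U₂ qk.2 qk.1 ≤
      (1 / π) * ((1 + Real.log Q) * (K * W)) + cV Q * ((2 * H) * (K * W) + U₂ * (Cr * (Q : ℝ) ^ δ * Q)) := by
    have e : ∑ qk ∈ P, sawMajorant Q U₂ qk.2 qk.1 =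
        (1 / π) * ∑ qk ∈ P, ∑ ν ∈ Icc 1 Q, geomBound U₂ ((ν : ℝ) * qk.2 / qk.1) / ν +
          cV Q * ∑ qk ∈ P, ∑ d ∈ Icc (-(H : ℤ)) H, geomBound U₂ ((d : ℝ) * qk.2 / qk.1) := by
      simp only [sawMajorant, hH, sum_add_distrib, mul_sum]
    rw [e]
    have hc := cV_nonneg Q
    gcongr
  -- Step 5: numerical absorption of the logarithms
  have hcV : cV Q * (2 * H) ≤ 30 * (Λ * (Q : ℝ) ^ δ) := by
    have h2Q : (0 : ℝ) < 2 * Q + 1 := by linarith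
    have e : cV Q * (2 * H) = 30 * (2 + Real.log (2 * Q + 1)) := by
      rw [cV, hH]; push_cast; field_simp; ring
    rw [e]
    nlinarith [two_add_log_le hQ hδ0]
  have hcV' : cV Q * ((U₂ : ℝ) * (Cr * (Q : ℝ) ^ δ * Q)) ≤ 3 * (Λ * (Q : ℝ) ^ δ) * (U₂ * (Cr * (Q : ℝ) ^ δ)) := by
    have h2Q : (0 : ℝ) < 2 * Q + 1 := by linarith
    have e : cV Q * ((U₂ : ℝ) * (Cr * (Q : ℝ) ^ δ * Q)) =
        3 * (2 + Real.log (2 * Q + 1)) * ((Q : ℝ) / (2 * Q + 1)) * (U₂ * (Cr * (Q : ℝ) ^ δ)) := by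
      rw [cV]; field_simp
    rw [e]
    have hq1 : (Q : ℝ) / (2 * Q + 1) ≤ 1 := by rw [div_le_one h2Q]; linarith
    have hl := two_add_log_le hQ hδ0
    have hpos : 0 ≤ 2 + Real.log (2 * Q + 1) := by
      have := Real.log_nonneg (by linarith : (1:ℝ) ≤ 2 * Q + 1); linarith
    have hU : 0 ≤ (U₂ : ℝ) * (Cr * (Q : ℝ) ^ δ) := by positivity
    calc 3 * (2 + Real.log (2 * Q + 1)) * ((Q : ℝ) / (2 * Q + 1)) * (U₂ * (Cr * (Q : ℝ) ^ δ))
        ≤ 3 * (2 + Real.log (2 * Q + 1)) * 1 * (U₂ * (Cr * (Q : ℝ) ^ δ)) := by gcongr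
      _ ≤ 3 * (Λ * (Q : ℝ) ^ δ) * (U₂ * (Cr * (Q : ℝ) ^ δ)) := by nlinarith
  have hlogQ : 1 + Real.log Q ≤ Λ * (Q : ℝ) ^ δ := by
    have := one_add_log_le hQ hδ0
    have h3 : (1 + 1 / δ) ≤ Λ := by rw [hΛ]; linarith
    nlinarith
  -- combine: everything is `≤ const · Q^{4δ} (U₂ + Q)` and `4δ = ε/2 ≤ ε`
  have hQpow : ∀ {a b : ℝ}, a ≤ b → (Q : ℝ) ^ a ≤ (Q : ℝ) ^ b := fun h => Real.rpow_le_rpow_of_exponent_le hQ1 h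
  have hKW : K * W ≤ κ * Λ * ((U₂ : ℝ) + Q) * (Q : ℝ) ^ (3 * δ) := by
    rw [hK]
    calc κ * (Q : ℝ) ^ (2 * δ) * W ≤ κ * (Q : ℝ) ^ (2 * δ) * (((U₂ : ℝ) + Q) * (Λ * (Q : ℝ) ^ δ)) := by
          gcongr
      _ = κ * Λ * ((U₂ : ℝ) + Q) * ((Q : ℝ) ^ (2 * δ) * (Q : ℝ) ^ δ) := by ring
      _ = κ * Λ * ((U₂ : ℝ) + Q) * (Q : ℝ) ^ (3 * δ) := by
          rw [← Real.rpow_add hQ0]; ring_nf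
  have hT1 : (1 / π) * ((1 + Real.log Q) * (K * W)) ≤
      ((1 / π) * Λ * κ * (2 * Λ)) * (((U₂ : ℝ) + Q) * (Q : ℝ) ^ ε) := by
    have hKW0 : 0 ≤ K * W := mul_nonneg hK0 hW0
    calc (1 / π) * ((1 + Real.log Q) * (K * W))
        ≤ (1 / π) * ((Λ * (Q : ℝ) ^ δ) * (κ * Λ * ((U₂ : ℝ) + Q) * (Q : ℝ) ^ (3 * δ))) := by
          gcongr
      _ = ((1 / π) * Λ * κ * Λ) * (((U₂ : ℝ) + Q) * ((Q : ℝ) ^ δ * (Q : ℝ) ^ (3 * δ))) := by ring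
      _ = ((1 / π) * Λ * κ * Λ) * (((U₂ : ℝ) + Q) * (Q : ℝ) ^ (4 * δ)) := by
          rw [← Real.rpow_add hQ0]; ring_nf
      _ ≤ ((1 / π) * Λ * κ * (2 * Λ)) * (((U₂ : ℝ) + Q) * (Q : ℝ) ^ ε) := by
          gcongr
          · linarith
          · rw [hδ]; linarith
  have hT2 : cV Q * ((2 * H) * (K * W)) ≤ (30 * Λ * κ * (2 * Λ)) * (((U₂ : ℝ) + Q) * (Q : ℝ) ^ ε) := by
    have hKW0 : 0 ≤ K * W := mul_nonneg hK0 hW0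
    calc cV Q * ((2 * H) * (K * W)) = (cV Q * (2 * H)) * (K * W) := by ring
      _ ≤ (30 * (Λ * (Q : ℝ) ^ δ)) * (κ * Λ * ((U₂ : ℝ) + Q) * (Q : ℝ) ^ (3 * δ)) := by gcongr
      _ = (30 * Λ * κ * Λ) * (((U₂ : ℝ) + Q) * ((Q : ℝ) ^ δ * (Q : ℝ) ^ (3 * δ))) := by ring
      _ = (30 * Λ * κ * Λ) * (((U₂ : ℝ) + Q) * (Q : ℝ) ^ (4 * δ)) := by
          rw [← Real.rpow_add hQ0]; ring_nf
      _ ≤ (30 * Λ * κ * (2 * Λ)) * (((U₂ : ℝ) + Q) * (Q : ℝ) ^ ε) := by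
          gcongr
          · linarith
          · rw [hδ]; linarith
  have hT3 : cV Q * ((U₂ : ℝ) * (Cr * (Q : ℝ) ^ δ * Q)) ≤ (3 * Λ * Cr) * (((U₂ : ℝ) + Q) * (Q : ℝ) ^ ε) := by
    calc cV Q * ((U₂ : ℝ) * (Cr * (Q : ℝ) ^ δ * Q)) ≤ 3 * (Λ * (Q : ℝ) ^ δ) * (U₂ * (Cr * (Q : ℝ) ^ δ)) := hcV'
      _ = (3 * Λ * Cr) * ((U₂ : ℝ) * ((Q : ℝ) ^ δ * (Q : ℝ) ^ δ)) := by ring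
      _ = (3 * Λ * Cr) * ((U₂ : ℝ) * (Q : ℝ) ^ (2 * δ)) := by rw [← Real.rpow_add hQ0]; ring_nf
      _ ≤ (3 * Λ * Cr) * (((U₂ : ℝ) + Q) * (Q : ℝ) ^ ε) := by
          gcongr
          · linarith
          · rw [hδ]; linarith
  -- assemble
  have hsum := step1.trans (mul_le_mul_of_nonneg_left hmaj (by norm_num))
  refine hsum.trans ?_
  rw [mul_add (cV Q)]
  have hnonneg : 0 ≤ ((U₂ : ℝ) + Q) * (Q : ℝ) ^ ε := by positivity
  nlinarith [hT1, hT2, hT3, hnonneg]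

/-- **Lemma 10, square case** (`U₁ = U₂ = U`, Heath-Brown's statement).
[cite: HeathBrown2001LargestPrimeFactorCubic, Lemma 10 p. 23] -/
theorem exists_sum_rootPairs_abs_Scount_sub_le {ε : ℝ} (hε : 0 < ε) :
    ∃ C : ℝ, 0 < C ∧ ∀ Q : ℕ, 1 ≤ Q → ∀ A B U : ℕ,
      ∑ qk ∈ rootPairs Q, |(Scount qk.1 qk.2 A B U : ℝ) - (U : ℝ) ^ 2 / qk.1| ≤
        C * ((U : ℝ) + Q) * (Q : ℝ) ^ ε := by
  obtain ⟨C, hC, h⟩ := exists_sum_rootPairs_abs_Scount₂_sub_le hε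
  refine ⟨C, hC, fun Q hQ A B U => ?_⟩
  have := h Q hQ A U B U
  simpa only [Scount₂_self, sq] using this

end Literature.NumberTheory.Sieve.HeathBrown2001
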